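import Mathlib
import HarnessLib
import Literature.MathematicalPhysics.StatisticalMechanics.StepOperatorBLipschitz

/-!
# `‖B_{𝒞a} K − B_{𝒞b} K‖_{k,0} ≤ C_{8.7} · C ℓ κ A^{−1}` for the torus data in the SCALE-`k` norm
# ([ABKM19] Lemma 12.6 (12.52) / Lemma 10.6 at scale `k`)

`StepOperatorBLipschitz.hamNorm_opB_sub_abkm_le_of_stepKernelBounds` instantiates the abstract pair bound
`hamNorm_opB_sub_le_succ` (scale `k+1`, factor `L^d`) for the torus data.  The extracted Hamiltonian
`H̃_k = A_kH + B_kK` is measured in the scale-`k` norm (`NextHamiltonianKernelSubTorusFRD.hamNorm_nextH_sub_of_torusFRD`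
leaves the term `‖B_{q'}K − B_qK‖_{k,0}`), so this file instantiates the scale-`k` twin
`hamNorm_opB_sub_le` in the same way:

* **`hamNorm_opB_sub_abkm_le_scale_of_stepKernelBounds`**.

Everything is proved; no named fact.

## References
* S. Adams, S. Buchholz, R. Kotecký, S. Müller, arXiv:1910.13564, Lemma 12.6 (12.52), Lemma 10.6
  [AdamsBuchholzKoteckyMuller2019].
-/

noncomputable section

namespace Literature.MathematicalPhysics.StatisticalMechanics.GradientRG

open scoped BigOperators Classical
open Finset
open Literature.MathematicalPhysics.StatisticalMechanics.TorusPolymer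
  (IsPolymer blocks numBlocks blockOf thicken mem_blockOf_self isPolymer_blockOf blocks_blockOf
    card_blocks_eq_numBlocks boxCorner subset_thicken card_blockOf)
open Literature.Barriers.CriticalPhenomena.LongRangePhi4.Polymer (IsConn)
open Literature.MathematicalPhysics.QuantumFieldTheory

variable {d M : ℕ} [NeZero M]

/-- **Lipschitz dependence of `B_k^{(q)}` on the step kernel for the torus data**: for `d ≥ 3`, `L` odd,
`L ≥ 2^{d+3} + 16R`, `M = L^N`, `k + 1 ≤ N`, the weight tower of Theorem 7.1, two step data of scale
`k` sharing the reference block and its box, whose kernels satisfy `StepKernelBounds`, the `ℓ = 1`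
integration property `hdiff` for the pair of kernels (e.g. from
`FluctuationKernelComparisonABKM.tayNormLE_fluct_sub_fluct_abkm`), and a local `C^{r₀}` activity with
`‖K‖_k^{(A)} ≤ C`, in the SCALE-`k` norm (the one of `H̃_k`): `‖B_{𝒞a} K − B_{𝒞b} K‖_{k,0} ≤ C_{8.7} · C ℓ κ A^{−1}`.
[cite: AdamsBuchholzKoteckyMuller2019, Lemma 12.6 (12.52)] -/
theorem hamNorm_opB_sub_abkm_le_scale_of_stepKernelBounds {L N Mord R n p r₀ : ℕ}
    {θbar lam μ δ₁ δ₀ A𝒫 A𝒫a A𝒫b C₂a C₂b h A : ℝ}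
    {𝒞 : ℕ → (Fin d → ZMod M) → ℝ} (hd : 3 ≤ d) (hLodd : Odd L) (hL : 2 ^ (d + 3) + 16 * R ≤ L)
    (hM : M = L ^ N) {k : ℕ} (hkN : k + 1 ≤ N) (hpM : p + d ≤ Mord) (hMR : Mord ≤ R)
    (hr₀ : 3 ≤ r₀)
    (hB : AbkmWeightBounds L N Mord R n θbar lam μ δ₁ δ₀ A𝒫 𝒞
      (abkmWeightData L N Mord R θbar (schedDelta δ₀ δ₁ N) 𝒞))
    (hh : 0 < h) (hA : 1 ≤ A)
    (Da Db : StepData d M)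
    (hSa : StepKernelBounds (abkmWeightData L N Mord R θbar (schedDelta δ₀ δ₁ N) 𝒞) L k A𝒫a C₂a Da.𝒞)
    (hSb : StepKernelBounds (abkmWeightData L N Mord R θbar (schedDelta δ₀ δ₁ N) 𝒞) L k A𝒫b C₂b Db.𝒞)
    {x₀ : Fin d → ZMod M} (hB₀ : Da.B₀ = blockOf (L ^ k) x₀)
    (hc₀ : Da.c₀ = boxCorner (L ^ k) (starRad R L d k) x₀) (hB₀' : Db.B₀ = Da.B₀) (hc₀' : Db.c₀ = Da.c₀)
    {ℓ κ : ℝ}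
    (hdiff : ∀ X : Finset (Fin d → ZMod M), IsPolymer (L ^ k) X → IsConn X →
      ∀ (F : ((Fin d → ZMod M) → ℝ) → ℂ) (C : ℝ), 0 ≤ C → ContDiff ℝ r₀ F →
        IsGaugeLocal ((abkmNormParams L N Mord R p r₀ h θbar A (schedDelta δ₀ δ₁ N) 𝒞).gauge k X) F →
        TayNormLE ((abkmNormParams L N Mord R p r₀ h θbar A (schedDelta δ₀ δ₁ N) 𝒞).gauge k X) r₀
          ((abkmWeightData L N Mord R θbar (schedDelta δ₀ δ₁ N) 𝒞).weight k X) F C →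
          TayNormLE ((abkmNormParams L N Mord R p r₀ h θbar A (schedDelta δ₀ δ₁ N) 𝒞).gauge k X) r₀
            ((abkmWeightData L N Mord R θbar (schedDelta δ₀ δ₁ N) 𝒞).midWeight k X)
            (fluct Da.𝒞 F - fluct Db.𝒞 F) (C * ℓ * κ ^ numBlocks (L ^ k) X))
    {K : Finset (Fin d → ZMod M) → ((Fin d → ZMod M) → ℝ) → ℂ} {C : ℝ} (hC : 0 ≤ C)
    (hK : WeakNormLE (abkmNormParams L N Mord R p r₀ h θbar A (schedDelta δ₀ δ₁ N) 𝒞) k K C)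
    (hKd : ∀ X, ContDiff ℝ r₀ (K X))
    (hKloc : ∀ X, IsPolymer (L ^ k) X → IsConn X →
      IsGaugeLocal ((abkmNormParams L N Mord R p r₀ h θbar A (schedDelta δ₀ δ₁ N) 𝒞).gauge k X) (K X)) :
    hamNorm (fieldWt h L d k) ((L : ℝ) ^ k) (L ^ (d * k)) (opB Da K - opB Db K) ≤
      pi2BoundConst d (((2 * R + 2 : ℕ) : ℝ) + ((d / 2 + 1 : ℕ) : ℝ)) * (C * ℓ * κ * A⁻¹) := by
  set P := abkmNormParams L N Mord R p r₀ h θbar A (schedDelta δ₀ δ₁ N) 𝒞 with hP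
  have h8 : 8 ≤ 2 ^ (d + 3) := by
    calc 8 = 2 ^ 3 := by norm_num
      _ ≤ 2 ^ (d + 3) := Nat.pow_le_pow_right (by norm_num) (by omega)
  have hL4 : 4 ≤ L := by omega
  have hL0 : (0 : ℝ) < L := by exact_mod_cast hLodd.pos
  have hpR : p ≤ R := by omega
  -- the torus at scale `k`
  obtain ⟨t, ht⟩ : ∃ t, N = k + t := ⟨N - k, by omega⟩
  have hMt0 : M = L ^ k * L ^ t := by rw [← pow_add, ← ht]; exact hM
  have hMt : M = P.L ^ k * L ^ t := hMt0
  have htodd : Odd (L ^ t) := hLodd.pow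
  -- weights of the two scales
  have h𝔥k : 0 < P.𝔥 k := fieldWt_pos hh hL0 d k
  have hsucc : P.𝔥 (k + 1) = scaleRatio d L * P.𝔥 k := fieldWt_succ_nat hLodd.pos d k
  have hR : 0 < P.R k := by show (0 : ℝ) < (L : ℝ) ^ k; positivity
  have hr₀' : 2 ≤ P.r₀ := by show 2 ≤ r₀; omega
  -- the box
  obtain ⟨hwrap0, hroom0⟩ := abkm_box_lt (d := d) hL hpR hkN
  have hwrap : 4 * ((P.L ^ k - 1) / 2 + P.rad k) < M := by
    show 4 * ((L ^ k - 1) / 2 + starRad R L d k) < M; rw [hM]; exact hwrap0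
  have hroom : ((2 * ((P.L ^ k - 1) / 2 + P.rad k) : ℕ) + (P.p : ℤ)) * 2 < M := by
    show ((2 * ((L ^ k - 1) / 2 + starRad R L d k) : ℕ) + (p : ℤ)) * 2 < (M : ℤ)
    rw [hM]; exact_mod_cast hroom0
  have hC₀ : (1 : ℝ) ≤ ((2 * R + 2 : ℕ) : ℝ) + ((d / 2 + 1 : ℕ) : ℝ) := by
    have : (1 : ℝ) ≤ ((2 * R + 2 : ℕ) : ℝ) := by exact_mod_cast (show 1 ≤ 2 * R + 2 by omega)
    linarith [(Nat.cast_nonneg (d / 2 + 1) : (0 : ℝ) ≤ _)]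
  have hρ0 : ((2 * ((P.L ^ k - 1) / 2 + P.rad k) : ℕ) : ℝ) + (d / 2 + 1 : ℕ) ≤
      (((2 * R + 2 : ℕ) : ℝ) + ((d / 2 + 1 : ℕ) : ℝ)) * P.R k := abkm_box_C0 (d := d) hL k
  -- `B_k K` only sees `K(B₀)`; replace `K` by its restriction to connected `k`-polymers
  set K' : Finset (Fin d → ZMod M) → ((Fin d → ZMod M) → ℝ) → ℂ :=
    fun X => if IsPolymer (L ^ k) X ∧ IsConn X then K X else 0 with hK'def
  have hMo : Odd M := by rw [hM]; exact hLodd.pow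
  have hPB : IsPolymer (L ^ k) Da.B₀ := by rw [hB₀]; exact isPolymer_blockOf _ x₀
  have hcB : IsConn Da.B₀ := by rw [hB₀]; exact TorusPolymer.isConn_blockOf hMo hLodd.pow x₀
  have hK'B : K' Da.B₀ = K Da.B₀ := by simp only [hK'def, hPB, hcB, and_self, if_true]
  have hopBa : opB Da K = opB Da K' := by unfold opB; rw [hK'B]
  have hopBb : opB Db K = opB Db K' := by unfold opB; rw [hB₀', hK'B]
  have hK' : WeakNormLE P k K' C := fun X hX hc => by
    have : K' X = K X := by
      show (if IsPolymer (L ^ k) X ∧ IsConn X then K X else 0) = K X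
      exact if_pos ⟨hX, hc⟩
    rw [this]; exact hK X hX hc
  have hK'd : ∀ X, ContDiff ℝ P.r₀ (K' X) := fun X => by
    by_cases hX : IsPolymer (L ^ k) X ∧ IsConn X
    · simp only [hK'def, if_pos hX]; exact hKd X
    · simp only [hK'def, if_neg hX]; exact contDiff_const
  have hK'loc : ∀ X, IsPolymer (P.L ^ k) X → IsConn X → IsGaugeLocal (P.gauge k X) (K' X) :=
    fun X hX hc => by
      have : K' X = K X := by
        show (if IsPolymer (L ^ k) X ∧ IsConn X then K X else 0) = K X
        exact if_pos ⟨hX, hc⟩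
      rw [this]; exact hKloc X hX hc
  have hA0 : 0 < A := by linarith
  have h0fl : ∀ 𝒞q : (Fin d → ZMod M) → ℝ, fluct 𝒞q (0 : ((Fin d → ZMod M) → ℝ) → ℂ) = fun _ => 0 := by
    intro 𝒞q; funext φ; unfold fluct; simp
  have hR'a : ∀ X, ContDiff ℝ P.r₀ (fluct Da.𝒞 (K' X)) := fun X => by
    by_cases hX : IsPolymer (L ^ k) X ∧ IsConn X
    · exact contDiff_fluct_of_weakNormLE_of_stepKernelBounds hB hSa hA0 hC hK' hK'd hK'loc hX.1 hX.2
    · have : K' X = 0 := by simp only [hK'def, if_neg hX]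
      rw [this, h0fl]; exact contDiff_const
  have hR'b : ∀ X, ContDiff ℝ P.r₀ (fluct Db.𝒞 (K' X)) := fun X => by
    by_cases hX : IsPolymer (L ^ k) X ∧ IsConn X
    · exact contDiff_fluct_of_weakNormLE_of_stepKernelBounds hB hSb hA0 hC hK' hK'd hK'loc hX.1 hX.2
    · have : K' X = 0 := by simp only [hK'def, if_neg hX]
      rw [this, h0fl]; exact contDiff_const
  -- the abstract estimate for `K'`
  have hmain := hamNorm_opB_sub_le P hMt hLodd htodd Da Db hB₀ hc₀ hB₀' hc₀' h𝔥k hR hr₀'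
    hwrap hroom hC₀ hρ0 (ℓ := ℓ) (κ := κ) hdiff hC hK' hK'd hK'loc hR'a hR'b hA
  -- bookkeeping: `|B₀| = L^{dk}`
  have hcard : Da.B₀.card = L ^ (d * k) := by
    rw [hB₀, card_blockOf hMt0 hLodd.pow htodd x₀, ← pow_mul, mul_comm]
  rw [hopBa, hopBb, ← hcard]
  exact hmain

end Literature.MathematicalPhysics.StatisticalMechanics.GradientRG

end
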